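import Summits.HubbardSuperconductivity.HubbardSuperconductivity.Theorems.KacWindowPenaltyWindowGapDressedReduction
import Summits.HubbardSuperconductivity.HubbardSuperconductivity.Theorems.WindowGap.Negative.FreeWindowCalibration

/-!
# Crux `WindowGap` (stmt-HubbardSuperconductivity-1088): the physics stub of line
# `sector-invisible-dressing` is FALSE at the free point `U = 0`

Negative-side corollary of the `U = 0` calibration (`not_windowGapAt_zero`) and the dressed reduction
at arbitrary coupling (`windowGapAt_of_windowOrderAt`): the `U := 0` instance of the line's one open
stub `stub_windowOrder` (robust quasi-average `d`-wave order of the charged, weakly window-repelled,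
weakly sourced grand-canonical torus, eventually in even `L`, for every small window radius) is
contradictory for every `δ ∈ (0, 1/2)`, every chemical potential `μ`, every order floor `m⋆ > 0`,
every charging constant `B ≥ 288 + |μ|` and every `ε₁ > 0` — the reduction would turn it into the crux
body at `(0, δ)`, which the free Fermi gas violates. So the stub is not idle bookkeeping: like the
crux, it needs the interaction. Nothing here asserts a Theses decl positively.

Sources: Bardeen–Cooper–Schrieffer, Phys. Rev. 108 (1957) 1175, §II; C. N. Yang, Rev. Mod. Phys.
34 (1962) 694, §3; P. W. Anderson, Phys. Rev. 112 (1958) 1900. Folklore; no named facts, no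
definitions.
-/

set_option linter.dupNamespace false

noncomputable section

namespace Summit.HubbardSuperconductivity.HubbardSuperconductivity.Theorems.WindowGap.Negative

open Matrix Literature.MathematicalPhysics.QuantumLattice
open Summit.HubbardSuperconductivity.HubbardSuperconductivity.Theorems

/-- **The `U = 0` instance of `stub_windowOrder` is false.** For every `δ ∈ (0,1/2)`, `μ`, `m⋆ > 0`,
`B ≥ 288 + |μ|`, `ε₁ > 0` it is NOT the case that for every `ε ∈ (0, ε₁]` some `λ > 0` makes,
eventually in even `L`, every unit ground state of the dressed FREE torus
`H_L(1,0) + λW_ε − μ(N̂ − N_L) + (B²/(λm⋆²L²))(N̂ − N_L)² − (λm⋆²/64)(Δ_d + Δ_dᴴ)` carry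
`Re ⟨φ, Δ_d φ⟩ ≥ m⋆L²`: otherwise `windowGapAt_of_windowOrderAt` (valid at any `U`) gives the crux
body at `(0, δ)`, against `not_windowGapAt_zero`. Bardeen–Cooper–Schrieffer (1957) §II; Yang (1962)
§3. [folklore] -/
theorem not_windowOrderAt_zero {δ μ mstar B ε₁ : ℝ} (hδ : δ ∈ Set.Ioo (0 : ℝ) (1 / 2))
    (hm : 0 < mstar) (hB : 288 + |μ| ≤ B) (hε₁ : 0 < ε₁) :
    ¬ (∀ ε ∈ Set.Ioc (0 : ℝ) ε₁, ∃ lam : ℝ, 0 < lam ∧ ∃ L₀ : ℕ, ∀ (L : ℕ) [NeZero L], L₀ ≤ L → Even L →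
        ∀ φ : Fock (Orb (FermionTorus 2 L)), star φ ⬝ᵥ φ = 1 →
          (star φ ⬝ᵥ (hubbardTorus 2 L 1 0 + (lam : ℂ) • (∑ m : Fin 2 → ZMod L,
              if (2 * Real.pi / (L : ℝ)) ^ 2 * (∑ i : Fin 2, (((m i).valMinAbs : ℤ) : ℝ) ^ 2) ≤ ε ^ 2
              then ((L : ℂ) ^ 2)⁻¹ • (Matrix.conjTranspose (pairFieldAt dWaveFormFactor L m) *
                pairFieldAt dWaveFormFactor L m)
              else 0) +
            (-((μ : ℂ) • ((totalNumber : Matrix (Finset (Orb (FermionTorus 2 L)))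
                (Finset (Orb (FermionTorus 2 L))) ℂ) - ((2 * ⌊(1 - δ) * (L : ℝ) ^ 2 / 2⌋₊ : ℕ) : ℂ) • 1)) +
              ((B ^ 2 / (lam * mstar ^ 2 * (L : ℝ) ^ 2) : ℝ) : ℂ) •
                (((totalNumber : Matrix (Finset (Orb (FermionTorus 2 L)))
                  (Finset (Orb (FermionTorus 2 L))) ℂ) - ((2 * ⌊(1 - δ) * (L : ℝ) ^ 2 / 2⌋₊ : ℕ) : ℂ) • 1) *
                ((totalNumber : Matrix (Finset (Orb (FermionTorus 2 L)))
                  (Finset (Orb (FermionTorus 2 L))) ℂ) - ((2 * ⌊(1 - δ) * (L : ℝ) ^ 2 / 2⌋₊ : ℕ) : ℂ) • 1)) -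
              ((lam * mstar ^ 2 / 64 : ℝ) : ℂ) •
                (pairField dWaveFormFactor L + (pairField dWaveFormFactor L)ᴴ))) *ᵥ φ).re =
            (hubbardTorus 2 L 1 0 + (lam : ℂ) • (∑ m : Fin 2 → ZMod L,
              if (2 * Real.pi / (L : ℝ)) ^ 2 * (∑ i : Fin 2, (((m i).valMinAbs : ℤ) : ℝ) ^ 2) ≤ ε ^ 2
              then ((L : ℂ) ^ 2)⁻¹ • (Matrix.conjTranspose (pairFieldAt dWaveFormFactor L m) *
                pairFieldAt dWaveFormFactor L m)
              else 0) +
            (-((μ : ℂ) • ((totalNumber : Matrix (Finset (Orb (FermionTorus 2 L)))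
                (Finset (Orb (FermionTorus 2 L))) ℂ) - ((2 * ⌊(1 - δ) * (L : ℝ) ^ 2 / 2⌋₊ : ℕ) : ℂ) • 1)) +
              ((B ^ 2 / (lam * mstar ^ 2 * (L : ℝ) ^ 2) : ℝ) : ℂ) •
                (((totalNumber : Matrix (Finset (Orb (FermionTorus 2 L)))
                  (Finset (Orb (FermionTorus 2 L))) ℂ) - ((2 * ⌊(1 - δ) * (L : ℝ) ^ 2 / 2⌋₊ : ℕ) : ℂ) • 1) *
                ((totalNumber : Matrix (Finset (Orb (FermionTorus 2 L)))
                  (Finset (Orb (FermionTorus 2 L))) ℂ) - ((2 * ⌊(1 - δ) * (L : ℝ) ^ 2 / 2⌋₊ : ℕ) : ℂ) • 1)) -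
              ((lam * mstar ^ 2 / 64 : ℝ) : ℂ) •
                (pairField dWaveFormFactor L + (pairField dWaveFormFactor L)ᴴ))).minEnergyOn ⊤ →
          mstar * (L : ℝ) ^ 2 ≤ (star φ ⬝ᵥ pairField dWaveFormFactor L *ᵥ φ).re) := by
  intro h
  have hB' : 144 * (2 + |(0 : ℝ)|) + |μ| ≤ B := by rw [abs_zero]; linarith
  exact not_windowGapAt_zero (δ := δ) (by linarith [hδ.1])
    (windowGapAt_of_windowOrderAt (U := 0) hδ hm hB' hε₁ h)

end Summit.HubbardSuperconductivity.HubbardSuperconductivity.Theorems.WindowGap.Negative
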